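import Mathlib
import Summits.Ventures.HodgeRepro.Tier4.Common.MixedPlaneKType
import Summits.Ventures.HodgeRepro.Tier4.Line1.PlaneDefs
import Summits.Ventures.HodgeRepro.Tier4.Line1.RationalRotation
import Summits.Ventures.HodgeRepro.Tier4.Line1.RowPlaneGenuine

/-!
# Tier4/Line1/MixedTransport — every definite genuine plane has a MIXED transported torus: a rational isometry `g`
whose transported lines `g W₀ g⁻¹`, `g W₁ g⁻¹` differ from both lines `W₀`, `W₁` (the answer, in the kernel, to the
critics' scope remark on `withTransportedTorus`: the degenerate face `g = 1`, `Q = P`, is not the only member)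

Blind re-derivation cell `pub-hodge-repro`, Tier 4 (README §9–§10), seat t4-L1-p3 (gen 2).  Target tree path
`lean/Summits/Ventures/HodgeRepro/Tier4/Line1/MixedTransport.lean`.  Imports typer-2's `Common.MixedPlaneKType`
(`PlaneData.withTransportedTorus`, `withTransportedTorus_Q`), `Line1.PlaneDefs`, this seat's g0 `Line1.RationalRotation`
(`exists_rational_rotation`: a rational isometry of the plane moving every non-zero vector of either `P`-line to a
vector with both `P`-components non-zero — the rotation behind J2.d′) and `Line1.RowPlaneGenuine`
(`isGenuineRow_withTransportedTorus`, `isDefinite_withTransportedTorus`).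

WHAT THIS IS.  The second torus of LINE L1 is `T′ = g (U(W₂) × U(W₃)) g⁻¹`, the transport of the second pair of
lines by the seesaw isometry (N1); in the typed plane it is `Q i := g (P i) g⁻¹` (`withTransportedTorus`).  crit-2
(S13309 / S13329) noted that `g = 1` gives the degenerate face `Q = P`, `T′ = T`, and that WHICH `g` is the seesaw's
is the costume's.  This file shows that the family is not the degenerate face alone: for EVERY definite genuine plane
there is a rational isometry `g` — the rotation of `exists_rational_rotation` — for which the transported plane is
again definite and genuine (`IsGenuineRow`, `IsDefinite`) and its two `Q`-lines are DIFFERENT from both `P`-lines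
(`exists_mixed_transport`); so the mixed tori `T′ ≠ T` the line's J2 (`IsLinRegular`, `exists_regular_rational`) is
built for are realised in the kernel.  Nothing here says which `g` is Liu's (free half).  Nothing here says anything
about the status of the Hodge conjecture for CM abelian varieties, which is NOT proved (HC_CM is NOT proved by anyone
in this repository).
-/

set_option autoImplicit false

noncomputable section

namespace Summit.Ventures.HodgeRepro.Tier4.Line1

open Common Matrix

section Mixed

variable {k : Type} [Field k] (W : PlaneData k)

/-- The two projectors of the first torus annihilate each other: `P 1 * P 0 = 0`. -/
theorem P_one_mul_P_zero : W.P 1 * W.P 0 = 0 := by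
  have h : W.P 1 = 1 - W.P 0 := by rw [← W.P_sum]; abel
  rw [h, sub_mul, one_mul, W.P_idem 0, sub_self]

/-- `P 0 * P 1 = 0`. -/
theorem P_zero_mul_P_one : W.P 0 * W.P 1 = 0 := by
  have h : W.P 0 = 1 - W.P 1 := by rw [← W.P_sum]; abel
  rw [h, sub_mul, one_mul, W.P_idem 1, sub_self]

/-- A rank-`2` projector is non-zero on some vector. -/
theorem exists_mulVec_ne_zero_of_rank (i : Fin 2) (hPr : (W.P i).rank = 2) : ∃ y : Fin 4 → k, W.P i *ᵥ y ≠ 0 := by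
  by_contra h
  push Not at h
  have h0 : W.P i = 0 := by
    ext a b
    have := congrFun (h (Pi.single b 1)) a
    simpa [Matrix.mulVec_single_one] using this
  rw [h0, Matrix.rank_zero] at hPr
  exact absurd hPr (by norm_num)

/-- **A vector with both `P`-components non-zero lies on neither `P`-line.** -/
theorem not_mem_range_P_of_components {v : Fin 4 → k} (h0 : W.P 0 *ᵥ v ≠ 0) (h1 : W.P 1 *ᵥ v ≠ 0) (j : Fin 2) :
    v ∉ LinearMap.range (W.P j).mulVecLin := by
  revert j
  rw [Fin.forall_fin_two]
  refine ⟨?_, ?_⟩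
  · rintro ⟨z, hz⟩
    rw [Matrix.mulVecLin_apply] at hz
    apply h1
    rw [← hz, Matrix.mulVec_mulVec, P_one_mul_P_zero, Matrix.zero_mulVec]
  · rintro ⟨z, hz⟩
    rw [Matrix.mulVecLin_apply] at hz
    apply h0
    rw [← hz, Matrix.mulVec_mulVec, P_zero_mul_P_one, Matrix.zero_mulVec]

/-- **Every definite genuine plane has a mixed transported torus**: a rational isometry `g` (`g Ω = Ω g`,
`g B gᵀ = B`, invertible) such that the transported plane is definite and genuine and each of its `Q`-lines differs
from both `P`-lines. -/
theorem exists_mixed_transport [NumberField k] (hW : IsDefinite W) (hg : IsGenuineRow W) :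
    ∃ (g g' : Matrix (Fin 4) (Fin 4) k) (hgg' : g * g' = 1) (hg'g : g' * g = 1) (hgΩ : g * W.Ω = W.Ω * g),
      IsGenuineRow (W.withTransportedTorus g g' hgg' hg'g hgΩ) ∧
      IsDefinite (W.withTransportedTorus g g' hgg' hg'g hgΩ) ∧
      ∀ i j : Fin 2, LinearMap.range ((W.withTransportedTorus g g' hgg' hg'g hgΩ).Q i).mulVecLin ≠
        LinearMap.range (W.P j).mulVecLin := by
  obtain ⟨⟨d, hΩ, hd⟩, hrow, hPB, -, hPr, -⟩ := id hg
  obtain ⟨γ, hγΩ, hγB, hunit, hmove⟩ := exists_rational_rotation W hW hΩ hd hrow hPB hPr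
  have hdet : IsUnit γ.det := (Matrix.isUnit_iff_isUnit_det γ).mp hunit
  have hgg' : γ * γ⁻¹ = 1 := Matrix.mul_nonsing_inv γ hdet
  have hg'g : γ⁻¹ * γ = 1 := Matrix.nonsing_inv_mul γ hdet
  refine ⟨γ, γ⁻¹, hgg', hg'g, hγΩ, isGenuineRow_withTransportedTorus W hg γ γ⁻¹ hgg' hg'g hγΩ hγB,
    isDefinite_withTransportedTorus W hW γ γ⁻¹ hgg' hg'g hγΩ, ?_⟩
  intro i j heq
  obtain ⟨y, hy⟩ := exists_mulVec_ne_zero_of_rank W i (hPr i)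
  have hq : W.P i *ᵥ y ∈ LinearMap.range (W.P i).mulVecLin := ⟨y, by rw [Matrix.mulVecLin_apply]⟩
  obtain ⟨h0, h1⟩ := hmove i (W.P i *ᵥ y) hq hy
  have hmem : γ *ᵥ (W.P i *ᵥ y) ∈ LinearMap.range ((W.withTransportedTorus γ γ⁻¹ hgg' hg'g hγΩ).Q i).mulVecLin := by
    refine ⟨γ *ᵥ y, ?_⟩
    rw [Matrix.mulVecLin_apply, withTransportedTorus_Q, Matrix.mulVec_mulVec, Matrix.mul_assoc, Matrix.mul_assoc,
      hg'g, Matrix.mul_one, ← Matrix.mulVec_mulVec]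
  rw [heq] at hmem
  exact not_mem_range_P_of_components W h0 h1 j hmem

end Mixed

end Summit.Ventures.HodgeRepro.Tier4.Line1

end
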